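import Literature.Analysis.FluidPDE.ElgindiHalfPiEstimates
import HarnessLib

/-!
# All `σ`-derivatives of `z_k = V_k/cos θ` extend continuously to `θ = π/2`
([Elgindi2021] §7.1 Proposition 7.1: regularity of the `L²` solution at the degenerate boundary)

Topic `Literature/Analysis/FluidPDE`. Proof file (everything proved, no definitions, no named
facts) on the proof path of the named fact
`Literature.Analysis.FluidPDE.Elgindi.ElgindiGhoulMasmoudi2021_stabilityCore`
(`ElgindiStabilityDecomposition.lean`). T. M. Elgindi, Ann. of Math. 194 (2021) =
arXiv:1904.04795, §7.1 Proposition 7.1 (p. 19 of the held text).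

The bootstrap at `θ = π/2` in the reflected variable `σ = π/2 − θ`: for a `TangentialFamily`,
every `∂_σ^l z_k` (`z_k = V_k(R, π/2 − σ)/sin σ`) extends jointly continuously to `σ = 0` on
`(0,∞) × [0,π/2)` (`extZeroUpTo_zRefl`). Induction on the order simultaneously for all `k`:
`z_k, ∂_σz_k` extend by `ElgindiHalfPiEstimates.lean`; the step uses
`∂_σz_k = −(1/sinc σ)³J_k`, `J_k = M₂[sinc²·n_k]` (the averaging operator, which preserves the
classes), `n_k = 4w_k + f̃_k + α²(w_{k+2} − w_{k+1}) + α(5+α)w_{k+1}` and `w_j = sin σ·z_j`.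
-/

noncomputable section

open MeasureTheory Set Real Filter Function
open _root_.Topology
open scoped ContDiff

namespace Literature.Analysis.FluidPDE

namespace Elgindi

/-! ### Coefficients on the full slab `[0, π/2)` -/

/-- A function of `σ` smooth on `(−π, π)` is a coefficient on the slab `[0, π/2)`. [folklore] -/
theorem isCoef_halfPi_of_theta {φ : ℝ → ℝ} (hφ : ContDiffOn ℝ ∞ φ (Ioo (-π) π)) : IsCoef (π / 2) (fun _ σ => φ σ) := by
  have hIoo : ∀ l, ContDiffOn ℝ ∞ (deriv^[l] φ) (Ioo (-π) π) := by
    intro l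
    induction l with
    | zero => exact hφ
    | succ l ih => rw [Function.iterate_succ_apply']; exact ih.deriv_of_isOpen isOpen_Ioo (by simp)
  refine ⟨fun l => ?_, ?_⟩
  · rw [iterate_dθ_of_theta]
    exact (hIoo l).continuousOn.comp continuous_snd.continuousOn fun p hp =>
      ⟨by linarith [hp.2.1, Real.pi_pos], by linarith [hp.2.2, Real.pi_pos]⟩
  · exact hφ.comp contDiffOn_snd fun p hp => ⟨by linarith [hp.2.1, Real.pi_pos], by linarith [hp.2.2, Real.pi_pos]⟩

/-- `sinc ≠ 0` on `(−π, π)`. [folklore] -/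
theorem sinc_ne_zero_of_mem {σ : ℝ} (hσ : σ ∈ Ioo (-π) π) : Real.sinc σ ≠ 0 := by
  rcases eq_or_ne σ 0 with h0 | h0
  · rw [h0, Real.sinc_zero]; exact one_ne_zero
  · rw [Real.sinc_of_ne_zero h0]
    refine div_ne_zero ?_ h0
    rcases lt_or_gt_of_ne h0 with hneg | hpos
    · have := Real.sin_neg_of_neg_of_neg_pi_lt hneg hσ.1; exact this.ne
    · exact (Real.sin_pos_of_pos_of_lt_pi hpos hσ.2).ne'

/-- The coefficient `−(1/sinc σ)³`. [folklore] -/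
theorem isCoef_inv_sinc_cube : IsCoef (π / 2) (fun _ σ => -(1 / Real.sinc σ) ^ 3) :=
  isCoef_halfPi_of_theta (((contDiffOn_const.div Literature.Analysis.Fourier.contDiff_sinc.contDiffOn
    fun _ hσ => sinc_ne_zero_of_mem hσ).pow 3).neg)

/-- The coefficient `sinc²σ`. [folklore] -/
theorem isCoef_sinc_sq : IsCoef (π / 2) (fun _ σ => Real.sinc σ ^ 2) :=
  isCoef_halfPi_of_theta (Literature.Analysis.Fourier.contDiff_sinc.pow 2).contDiffOn

/-- The coefficient `sin σ`. [folklore] -/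
theorem isCoef_sin : IsCoef (π / 2) (fun _ σ => Real.sin σ) := isCoef_halfPi_of_theta Real.contDiff_sin.contDiffOn

/-! ### The bootstrap -/

namespace TangentialFamily

variable {α : ℝ} {f Ψ : ℝ → ℝ → ℝ} (h : TangentialFamily α f Ψ)
include h

/-- `J_k ∈ C^∞(strip)`. [folklore] -/
theorem smooth_jRefl (k : ℕ) : ContDiffOn ℝ ∞ (uncurry (jRefl Ψ k)) strip := by
  have e : uncurry (jRefl Ψ k) = fun p : ℝ × ℝ => -uncurry (pRefl Ψ k) p / p.2 ^ 3 := by funext p; rfl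
  rw [e]
  exact (h.smooth_pRefl k).neg.div (by fun_prop) fun p hp => pow_ne_zero 3 hp.2.1.ne'

/-- `r_k ∈ C^∞(strip)`. [folklore] -/
theorem smooth_rRefl (k : ℕ) : ContDiffOn ℝ ∞ (uncurry (rRefl α f Ψ k)) strip :=
  contDiffOn_mul_strip isCoef_sinc_sq.2 (h.smooth_nRefl k)

/-- **All `σ`-derivatives of every `z_k` extend jointly continuously to `σ = 0`** on
`(0,∞) × [0,π/2)`. [cite: Elgindi2021, §7.1 Proposition 7.1 (p. 19 of arXiv:1904.04795)] -/
theorem extZeroUpTo_zRefl (m : ℕ) : ∀ k : ℕ, ExtZeroUpTo (π / 2) m (zRefl Ψ k) := by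
  have hπ2 : (0:ℝ) < π / 2 := by positivity
  induction m with
  | zero => intro k l hl; have : l = 0 := Nat.le_zero.1 hl; subst this; exact h.extZero_zRefl k
  | succ m ih =>
    intro k
    refine extZeroUpTo_succ_iff.2 ⟨h.extZero_zRefl k, ?_⟩
    -- `∂_σz_k = −(1/sinc σ)³·J_k` on the strip
    rw [extZeroUpTo_congr le_rfl (g' := fun R σ => -(1 / Real.sinc σ) ^ 3 * jRefl Ψ k R σ) (fun p hp => h.dθ_zRefl_eq_sinc k hp)]
    refine ExtZeroUpTo.coef_mul hπ2 le_rfl m isCoef_inv_sinc_cube (h.smooth_jRefl k) ?_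
    -- `J_k = M₂[r_k]` on the strip, and `M₂` preserves the classes
    rw [extZeroUpTo_congr le_rfl (fun p hp => h.jRefl_eq_avgM k hp)]
    refine extZeroUpTo_avgM 2 m (h.smooth_rRefl k) ?_
    -- `r_k = sinc²·n_k`
    refine ExtZeroUpTo.coef_mul hπ2 le_rfl m isCoef_sinc_sq (h.smooth_nRefl k) ?_
    -- `n_k = 4w_k + f̃_k + α²(w_{k+2} − w_{k+1}) + α(5+α)w_{k+1}`, `w_j = sin σ·z_j`
    have hw : ∀ j, ExtZeroUpTo (π / 2) m (wRefl Ψ j) := fun j => by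
      rw [extZeroUpTo_congr le_rfl (g' := fun R σ => Real.sin σ * zRefl Ψ j R σ) (fun p hp => wRefl_eq j hp)]
      exact ExtZeroUpTo.coef_mul hπ2 le_rfl m isCoef_sin (h.smooth_zRefl j) (ih j)
    have hd : ExtZeroUpTo (π / 2) m (refl (Dz^[k] f)) := extZeroUpTo_of_contDiff hπ2 (h.smooth_refl_datum k) m
    have sw : ∀ j, ContDiffOn ℝ ∞ (uncurry (wRefl Ψ j)) strip := h.smooth_wRefl
    have sd : ContDiffOn ℝ ∞ (uncurry (refl (Dz^[k] f))) strip := (contDiff_infty.2 (h.smooth_refl_datum k)).contDiffOn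
    have t1 : ExtZeroUpTo (π / 2) m (fun R σ => 4 * wRefl Ψ k R σ) := (hw k).const_mul hπ2 4
    have s1 : ContDiffOn ℝ ∞ (uncurry fun R σ => 4 * wRefl Ψ k R σ) strip := contDiffOn_const.mul (sw k)
    have t12 := t1.add hπ2 le_rfl s1 sd hd
    have s12 := contDiffOn_add_strip s1 sd
    have t3 : ExtZeroUpTo (π / 2) m (fun R σ => α ^ 2 * (wRefl Ψ (k + 2) R σ - wRefl Ψ (k + 1) R σ)) :=
      ((hw (k + 2)).sub hπ2 le_rfl (sw (k + 2)) (sw (k + 1)) (hw (k + 1))).const_mul hπ2 (α ^ 2)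
    have s3 : ContDiffOn ℝ ∞ (uncurry fun R σ => α ^ 2 * (wRefl Ψ (k + 2) R σ - wRefl Ψ (k + 1) R σ)) strip :=
      contDiffOn_const.mul ((sw (k + 2)).sub (sw (k + 1)))
    have t123 := t12.add hπ2 le_rfl s12 s3 t3
    have s123 := contDiffOn_add_strip s12 s3
    have t4 : ExtZeroUpTo (π / 2) m (fun R σ => α * (5 + α) * wRefl Ψ (k + 1) R σ) := (hw (k + 1)).const_mul hπ2 _
    have s4 : ContDiffOn ℝ ∞ (uncurry fun R σ => α * (5 + α) * wRefl Ψ (k + 1) R σ) strip := contDiffOn_const.mul (sw (k + 1))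
    have t1234 := t123.add hπ2 le_rfl s123 s4 t4
    exact t1234

/-- **Corollary**: every `∂_σ^l z_k`, extended to `σ = 0` by its one-sided limit, is jointly
continuous on `(0,∞) × [0,π/2)`. [cite: Elgindi2021, §7.1 Proposition 7.1 (p. 19 of arXiv:1904.04795)] -/
theorem continuousOn_bext_zRefl (k l : ℕ) : ContinuousOn (bext (dθ^[l] (zRefl Ψ k))) (Ioi 0 ×ˢ Ico 0 (π / 2)) :=
  h.extZeroUpTo_zRefl l k l le_rfl

end TangentialFamily

end Elgindi

end Literature.Analysis.FluidPDE
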